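import Mathlib
import Literature.GroupTheory.PermutationGroups.SmallIndexSubgroups

/-!
# Entropy support theorem, layer 4: block systems of a transitive permutation group

Helper file for stub `entropySupportTheorem` of crux `SymmetryBudget.WindowBarrier`
(item stmt-PneNP-2145, line `bijection-gauge-twin-iso`).  For a transitive `T ≤ Sym(β)` and a
block `B` (a finite set whose translates are equal or disjoint), set-wise: the translates cover
`β`, are pairwise equal-or-disjoint, have `|B|` points each and are permuted by `T`; the kernel `K`
of the action of `T` on the translates (membership, `|X| ≤ b! · |X ∩ K|` for `X ≤ T`,
`|N| ≤ (a!)^b` for `N ≤ K`, and **`|K| ≤ |P|^b`**, `est_card_kernel_le_pow`, where `P ≤ Sym(B)` is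
the group induced on `B` by the set-wise stabiliser `T_B`); `P` is transitive, and primitive when
`B` is a block of minimal size `≥ 2` (`EST.isPreprimitive_of_minimal`).  No definitions.
-/

-- `Summit.PneNP.PneNP.…` duplicates `PneNP` BY DESIGN (single-problem summit).
set_option linter.dupNamespace false

namespace Summit.PneNP.PneNP.Theorems

open Equiv Equiv.Perm MulAction Subgroup
open Literature.GroupTheory.PermutationGroups (restr restr_apply_coe perm_apply_inv_self
  perm_inv_apply_self)
open scoped Pointwise

namespace EST

variable {β : Type*} [Fintype β] [DecidableEq β]

omit [Fintype β] in
/-- Membership in a translate: `u ∈ g • C ↔ g⁻¹ u ∈ C`. -/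
theorem mem_smul_finset_iff_inv_apply_mem (g : Perm β) (C : Finset β) (u : β) :
    u ∈ g • C ↔ g⁻¹ u ∈ C := by
  rw [← Finset.inv_smul_mem_iff]; rfl

omit [Fintype β] in
/-- Membership in the orbit of a finite set under a subgroup of `Sym(β)`. -/
theorem mem_orbit_subgroup_iff (T : Subgroup (Perm β)) (B C : Finset β) :
    C ∈ orbit T B ↔ ∃ g ∈ T, g • B = C := by
  rw [mem_orbit_iff]
  exact ⟨fun ⟨t, h⟩ => ⟨t, t.2, h⟩, fun ⟨g, hg, h⟩ => ⟨⟨g, hg⟩, h⟩⟩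

omit [Fintype β] in
/-- `T` permutes the translates of `B`. -/
theorem smul_mem_orbit_of_mem (T : Subgroup (Perm β)) (B : Finset β) {g : Perm β} (hg : g ∈ T)
    {C : Finset β} (hC : C ∈ orbit T B) : g • C ∈ orbit T B := by
  rw [mem_orbit_subgroup_iff] at hC ⊢
  obtain ⟨h, hh, rfl⟩ := hC
  exact ⟨g * h, T.mul_mem hg hh, mul_smul g h B⟩

omit [Fintype β] in
/-- Translates have the cardinality of `B`. -/
theorem card_eq_of_mem_orbit (T : Subgroup (Perm β)) (B : Finset β) {C : Finset β}
    (hC : C ∈ orbit T B) : C.card = B.card := by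
  obtain ⟨g, _, rfl⟩ := (mem_orbit_subgroup_iff T B C).1 hC
  exact Finset.card_smul_finset g B

omit [Fintype β] in
/-- A translate of a block is the block or is disjoint from it. -/
theorem smul_eq_or_disjoint (T : Subgroup (Perm β)) (B : Finset β) (hB : IsBlock T (B : Set β))
    {g : Perm β} (hg : g ∈ T) : g • B = B ∨ Disjoint (g • B) B := by
  rcases hB.smul_eq_or_disjoint ⟨g, hg⟩ with h | h
  · left
    apply Finset.coe_injective
    rw [Finset.coe_smul_finset]
    exact h
  · right
    rw [← Finset.disjoint_coe, Finset.coe_smul_finset]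
    exact h

omit [Fintype β] in
/-- Two translates of a block are equal or disjoint. -/
theorem eq_or_disjoint_of_mem_orbit (T : Subgroup (Perm β)) (B : Finset β)
    (hB : IsBlock T (B : Set β)) {C C' : Finset β} (hC : C ∈ orbit T B) (hC' : C' ∈ orbit T B) :
    C = C' ∨ Disjoint C C' := by
  obtain ⟨g, hg, rfl⟩ := (mem_orbit_subgroup_iff T B C).1 hC
  obtain ⟨g', hg', rfl⟩ := (mem_orbit_subgroup_iff T B C').1 hC'
  rcases smul_eq_or_disjoint T B hB (T.mul_mem (T.inv_mem hg') hg) with h | h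
  · left
    rw [mul_smul] at h
    have := congrArg (fun D => g' • D) h
    simpa only [smul_inv_smul] using this
  · right
    rw [mul_smul] at h
    rw [Finset.disjoint_left]
    intro v hv hv'
    exact Finset.disjoint_left.1 h (Finset.smul_mem_smul_finset hv) (Finset.inv_smul_mem_iff.2 hv')

omit [Fintype β] in
/-- For a transitive group and a non-empty block, the translates cover `β`. -/
theorem exists_mem_translate (T : Subgroup (Perm β)) [IsPretransitive T β] (B : Finset β)
    (hBne : B.Nonempty) (u : β) : ∃ C ∈ orbit T B, u ∈ C := by
  obtain ⟨y, hy⟩ := hBne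
  obtain ⟨t, ht⟩ := exists_smul_eq T y u
  refine ⟨t • B, mem_orbit B t, ?_⟩
  rw [← ht]
  exact Finset.smul_mem_smul_finset hy

omit [Fintype β] in
/-- The point reached from `B` determines the translate: if `g u ∈ C` for some `u ∈ B` and a
translate `C`, then `g • B = C`. -/
theorem smul_eq_of_apply_mem (T : Subgroup (Perm β)) (B : Finset β) (hB : IsBlock T (B : Set β))
    {g : Perm β} (hg : g ∈ T) {C : Finset β} (hC : C ∈ orbit T B) {u : β} (hu : u ∈ B)
    (hgu : g u ∈ C) : g • B = C := by
  rcases eq_or_disjoint_of_mem_orbit T B hB ((mem_orbit_subgroup_iff T B _).2 ⟨g, hg, rfl⟩) hC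
    with h | h
  · exact h
  · exact absurd hgu (Finset.disjoint_left.1 h (Finset.smul_mem_smul_finset hu))

/-! ### The kernel of the action on the translates -/

omit [Fintype β] in
/-- An element of `T` acts trivially on the orbit of `B` iff it fixes every translate. -/
theorem toPermHom_eq_one_iff (T : Subgroup (Perm β)) (B : Finset β) (t : T) :
    MulAction.toPermHom T (orbit T B) t = 1 ↔ ∀ C ∈ orbit T B, (t : Perm β) • C = C := by
  constructor
  · intro h C hC
    have := congrArg (fun f : Perm (orbit T B) => ((f ⟨C, hC⟩ : orbit T B) : Finset β)) h
    simp only [toPermHom_apply, toPerm_apply, Perm.coe_one, id_eq, orbit.coe_smul] at this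
    exact this
  · intro h
    refine Equiv.ext fun C => Subtype.ext ?_
    simp only [toPermHom_apply, toPerm_apply, Perm.coe_one, id_eq, orbit.coe_smul]
    exact h C C.2

omit [Fintype β] in
/-- Membership in the kernel `K` of the action of `T` on the translates of `B`. -/
theorem mem_kernel_iff (T : Subgroup (Perm β)) (B : Finset β) (k : Perm β) :
    k ∈ ((MulAction.toPermHom T (orbit T B)).ker).map T.subtype ↔
      k ∈ T ∧ ∀ C ∈ orbit T B, k • C = C := by
  refine ⟨fun ⟨t, ht, h⟩ => h ▸ ⟨t.2, (toPermHom_eq_one_iff T B t).1 ht⟩, fun ⟨hk, h⟩ => ?_⟩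
  exact ⟨⟨k, hk⟩, (toPermHom_eq_one_iff T B ⟨k, hk⟩).2 h, rfl⟩

omit [Fintype β] in
/-- Elements of the kernel leave every translate invariant (pointwise form). -/
theorem kernel_apply_mem_iff (T : Subgroup (Perm β)) (B : Finset β) {k : Perm β}
    (hk : k ∈ ((MulAction.toPermHom T (orbit T B)).ker).map T.subtype) {C : Finset β}
    (hC : C ∈ orbit T B) (u : β) : k u ∈ C ↔ u ∈ C := by
  have h := ((mem_kernel_iff T B k).1 hk).2 C hC
  conv_lhs => rw [← h]
  exact Finset.smul_mem_smul_finset_iff k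

omit [Fintype β] in
/-- The kernel is normalised by `T`. -/
theorem conj_mem_kernel (T : Subgroup (Perm β)) (B : Finset β) {t : Perm β} (ht : t ∈ T) {k : Perm β}
    (hk : k ∈ ((MulAction.toPermHom T (orbit T B)).ker).map T.subtype) :
    t * k * t⁻¹ ∈ ((MulAction.toPermHom T (orbit T B)).ker).map T.subtype := by
  rw [mem_kernel_iff] at hk ⊢
  refine ⟨T.mul_mem (T.mul_mem ht hk.1) (T.inv_mem ht), fun C hC => ?_⟩
  rw [mul_smul, mul_smul, hk.2 _ (smul_mem_orbit_of_mem T B (T.inv_mem ht) hC), smul_inv_smul]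

/-- **`|X| ≤ b! · |X ∩ K|`** for `X ≤ T`, `b` the number of translates of `B`: the group `X`
acts on the translates with kernel `X ∩ K`. -/
theorem card_le_factorial_mul_card_inf_kernel (T : Subgroup (Perm β)) (B : Finset β)
    (X : Subgroup (Perm β)) (hXT : X ≤ T) :
    Nat.card X ≤ (Nat.card (orbit T B)).factorial *
      Nat.card ↥(X ⊓ ((MulAction.toPermHom T (orbit T B)).ker).map T.subtype) := by
  classical
  set φ : X →* Perm (orbit T B) := (MulAction.toPermHom T (orbit T B)).comp (Subgroup.inclusion hXT)
    with hφ
  have h1 : Nat.card X = Nat.card φ.ker * Nat.card φ.range := by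
    rw [← φ.ker.card_mul_index, Subgroup.index_ker]
  have h2 : Nat.card φ.range ≤ (Nat.card (orbit T B)).factorial := by
    rw [← Nat.card_perm]
    exact Nat.card_le_card_of_injective _ Subtype.val_injective
  have hker : ∀ x : X, x ∈ φ.ker ↔ ∀ C ∈ orbit T B, (x : Perm β) • C = C := by
    intro x
    rw [MonoidHom.mem_ker, hφ, MonoidHom.comp_apply]
    exact toPermHom_eq_one_iff T B (Subgroup.inclusion hXT x)
  have h3 : Nat.card φ.ker =
      Nat.card ↥(X ⊓ ((MulAction.toPermHom T (orbit T B)).ker).map T.subtype) := by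
    refine Nat.card_congr ?_
    exact
      { toFun := fun x => ⟨x.1, Subgroup.mem_inf.2 ⟨x.1.2,
          (mem_kernel_iff T B _).2 ⟨hXT x.1.2, (hker x.1).1 x.2⟩⟩⟩
        invFun := fun x => ⟨⟨x.1, (Subgroup.mem_inf.1 x.2).1⟩,
          (hker _).2 ((mem_kernel_iff T B _).1 (Subgroup.mem_inf.1 x.2).2).2⟩
        left_inv := fun x => rfl
        right_inv := fun x => rfl }
  rw [h1, h3, mul_comm]
  exact Nat.mul_le_mul_right _ h2

/-- The kernel preserves every translate, so `|N| ≤ (a!)^b` for every `N ≤ K`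
(`a = |B|`, `b` translates), by the library's `card_le_prod_factorial_of_mapsTo`. -/
theorem card_le_pow_of_le_kernel (T : Subgroup (Perm β)) [IsPretransitive T β] (B : Finset β)
    (hBne : B.Nonempty) (N : Subgroup (Perm β))
    (hN : N ≤ ((MulAction.toPermHom T (orbit T B)).ker).map T.subtype) :
    Nat.card N ≤ B.card.factorial ^ Nat.card (orbit T B) := by
  classical
  have h := Literature.GroupTheory.PermutationGroups.card_le_prod_factorial_of_mapsTo
    (fun C : orbit T B => (C : Finset β))
    (fun u => by
      obtain ⟨C, hC, hu⟩ := exists_mem_translate T B hBne u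
      exact ⟨⟨C, hC⟩, hu⟩)
    N (fun k hk C u hu => (kernel_apply_mem_iff T B (hN hk) C.2 u).2 hu)
  have hcard : ∀ C : orbit T B, ((C : Finset β)).card = B.card := fun C => card_eq_of_mem_orbit T B C.2
  simp only [hcard, Finset.prod_const, Finset.card_univ] at h
  rwa [← Nat.card_eq_fintype_card] at h

/-! ### The group induced on a block by its stabiliser -/

omit [Fintype β] in
/-- Membership in the set-wise stabiliser `T_B` (as a subgroup of `Sym(β)`). -/
theorem mem_stabilizer_map_iff (T : Subgroup (Perm β)) (B : Finset β) (g : Perm β) :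
    g ∈ (stabilizer T B).map T.subtype ↔ g ∈ T ∧ g • B = B := by
  exact ⟨fun ⟨t, ht, h⟩ => h ▸ ⟨t.2, ht⟩, fun ⟨hg, h⟩ => ⟨⟨g, hg⟩, h, rfl⟩⟩

omit [Fintype β] in
/-- The stabiliser leaves `B` invariant (pointwise form needed by `restr`). -/
theorem stabilizer_apply_mem_iff (T : Subgroup (Perm β)) (B : Finset β) :
    ∀ g ∈ (stabilizer T B).map T.subtype, ∀ u, g u ∈ B ↔ u ∈ B := by
  intro g hg u
  obtain ⟨_, h⟩ := (mem_stabilizer_map_iff T B g).1 hg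
  conv_lhs => rw [← h]
  exact Finset.smul_mem_smul_finset_iff g

omit [Fintype β] in
/-- For a transitive `T` and a block `B`, the stabiliser `T_B` is transitive on `B`. -/
theorem isPretransitive_stabilizer (T : Subgroup (Perm β)) [IsPretransitive T β] (B : Finset β)
    (hB : IsBlock T (B : Set β)) :
    IsPretransitive
      ↥(restr ((stabilizer T B).map T.subtype) (fun u => u ∈ B) (stabilizer_apply_mem_iff T B)).range
      {u // u ∈ B} := by
  refine ⟨fun x y => ?_⟩
  obtain ⟨t, ht⟩ := exists_smul_eq T x.1 y.1
  have ht' : (t : Perm β) x.1 = y.1 := ht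
  have htB : (t : Perm β) • B = B :=
    smul_eq_of_apply_mem T B hB t.2 (mem_orbit_self B) x.2 (by rw [ht']; exact y.2)
  have htmem : (t : Perm β) ∈ (stabilizer T B).map T.subtype :=
    (mem_stabilizer_map_iff T B _).2 ⟨t.2, htB⟩
  exact ⟨⟨restr _ _ (stabilizer_apply_mem_iff T B) ⟨t, htmem⟩, ⟨_, rfl⟩⟩, Subtype.ext ht'⟩

/-- **A block of minimal size carries a primitive group**: if `B` is a block with `|B| ≥ 2` of
minimal cardinality among such blocks, the group induced on `B` by `T_B` is primitive. -/
theorem isPreprimitive_of_minimal (T : Subgroup (Perm β)) [IsPretransitive T β] (B : Finset β)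
    (hB : IsBlock T (B : Set β))
    (hmin : ∀ C : Finset β, IsBlock T (C : Set β) → 2 ≤ C.card → B.card ≤ C.card) :
    IsPreprimitive
      ↥(restr ((stabilizer T B).map T.subtype) (fun u => u ∈ B) (stabilizer_apply_mem_iff T B)).range
      {u // u ∈ B} := by
  classical
  haveI := isPretransitive_stabilizer T B hB
  set TB := (stabilizer T B).map T.subtype with hTB
  set res := restr TB (fun u => u ∈ B) (stabilizer_apply_mem_iff T B) with hres
  set P := res.range with hP
  refine { isTrivialBlock_of_isBlock := fun {C} hC => ?_ }
  -- lift `C` to a finite subset `C'` of `B`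
  set C' : Finset β := Finset.univ.filter fun u => ∃ h : u ∈ B, (⟨u, h⟩ : {u // u ∈ B}) ∈ C
    with hC'
  have hmemC' : ∀ u, u ∈ C' ↔ ∃ h : u ∈ B, (⟨u, h⟩ : {u // u ∈ B}) ∈ C := fun u => by simp [hC']
  have hmemC'' : ∀ w : {u // u ∈ B}, (w : β) ∈ C' ↔ w ∈ C := fun w => by
    rw [hmemC']; exact ⟨fun ⟨_, h⟩ => h, fun h => ⟨w.2, h⟩⟩
  have hC'B : C' ⊆ B := fun u hu => ((hmemC' u).1 hu).1
  -- `C'` is a block for `T`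
  have hC'block : IsBlock T (C' : Set β) := by
    rw [isBlock_iff_smul_eq_or_disjoint]
    intro t
    suffices h : (t : Perm β) • C' = C' ∨ Disjoint ((t : Perm β) • C') C' by
      have e : t • (C' : Set β) = (((t : Perm β) • C' : Finset β) : Set β) := by
        rw [Finset.coe_smul_finset]; rfl
      rcases h with h | h
      · left; rw [e, h]
      · right; rw [e, Finset.disjoint_coe]; exact h
    rcases smul_eq_or_disjoint T B hB t.2 with htB | htB
    · -- `t` stabilises `B`: use that `C` is a block for `P`
      have htmem : (t : Perm β) ∈ TB := (mem_stabilizer_map_iff T B _).2 ⟨t.2, htB⟩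
      set p : P := ⟨res ⟨t, htmem⟩, ⟨_, rfl⟩⟩ with hp
      have hpC : ∀ w : {u // u ∈ B}, w ∈ p • C ↔ ∃ y ∈ C, (t : Perm β) y = w := by
        intro w
        rw [Subgroup.smul_def, Set.mem_smul_set]
        constructor
        · rintro ⟨y, hy, hyw⟩
          exact ⟨y, hy, by rw [← hyw]; rfl⟩
        · rintro ⟨y, hy, hyw⟩
          exact ⟨y, hy, Subtype.ext hyw⟩
      have htC' : ∀ v, v ∈ (t : Perm β) • C' ↔ ∃ u ∈ C', (t : Perm β) u = v := fun v =>
        Finset.mem_smul_finset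
      rcases (isBlock_iff_smul_eq_or_disjoint.1 hC) p with hpC' | hpC'
      · left
        ext v
        rw [htC']
        constructor
        · rintro ⟨u, hu, rfl⟩
          obtain ⟨huB, huC⟩ := (hmemC' u).1 hu
          have hvB : (t : Perm β) u ∈ B := (stabilizer_apply_mem_iff T B _ htmem u).2 huB
          have : (⟨(t : Perm β) u, hvB⟩ : {u // u ∈ B}) ∈ p • C := (hpC _).2 ⟨⟨u, huB⟩, huC, rfl⟩
          rw [hpC'] at this
          exact (hmemC' _).2 ⟨hvB, this⟩
        · intro hv
          obtain ⟨hvB, hvC⟩ := (hmemC' v).1 hv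
          rw [← hpC', hpC] at hvC
          obtain ⟨y, hy, hyv⟩ := hvC
          exact ⟨y, (hmemC'' y).2 hy, hyv⟩
      · right
        rw [Finset.disjoint_left]
        rintro v hv hv'
        obtain ⟨u, hu, rfl⟩ := (htC' v).1 hv
        obtain ⟨huB, huC⟩ := (hmemC' u).1 hu
        obtain ⟨hvB, hvC⟩ := (hmemC' _).1 hv'
        have : (⟨(t : Perm β) u, hvB⟩ : {u // u ∈ B}) ∈ p • C := (hpC _).2 ⟨⟨u, huB⟩, huC, rfl⟩
        exact Set.disjoint_left.1 hpC' this hvC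
    · right
      rw [Finset.disjoint_left]
      intro v hv hv'
      rw [mem_smul_finset_iff_inv_apply_mem] at hv
      refine Finset.disjoint_left.1 htB ?_ (hC'B hv')
      rw [mem_smul_finset_iff_inv_apply_mem]
      exact hC'B hv
  -- minimality: `C'` is all of `B` or has at most one point
  by_cases h2 : 2 ≤ C'.card
  · right
    have hCB : C' = B := Finset.eq_of_subset_of_card_le hC'B (hmin C' hC'block h2)
    rw [Set.eq_univ_iff_forall]
    intro w
    have hw : (w : β) ∈ C' := by rw [hCB]; exact w.2
    exact (hmemC'' w).1 hw
  · left
    intro w hw w' hw'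
    have h1 : C'.card ≤ 1 := by omega
    exact Subtype.ext (Finset.card_le_one.1 h1 _ ((hmemC'' w).2 hw) _ ((hmemC'' w').2 hw'))

end EST

open EST in
/-- **The kernel is controlled by the block group**: for a transitive `T ≤ Sym(β)` and a
non-empty block `B` with `b` translates, the kernel `K` of the action of `T` on the translates
satisfies `|K| ≤ |P|^b`, where `P ≤ Sym(B)` is the group induced on `B` by the set-wise
stabiliser `T_B` (conjugating by an element carrying `B` to a translate `C` turns the action of
`K` on `C` into an action on `B` inside `P`, and `K` acts faithfully on the union of the
translates). -/
theorem est_card_kernel_le_pow :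
    ∀ {β : Type*} [Fintype β] [DecidableEq β] (T : Subgroup (Equiv.Perm β))
      [MulAction.IsPretransitive T β] (B : Finset β), B.Nonempty →
      Nat.card ↥(((MulAction.toPermHom T (MulAction.orbit T B)).ker).map T.subtype) ≤
        Nat.card ↥(Literature.GroupTheory.PermutationGroups.restr
            ((MulAction.stabilizer T B).map T.subtype) (fun u => u ∈ B)
            (Summit.PneNP.PneNP.Theorems.EST.stabilizer_apply_mem_iff T B)).range ^
          Nat.card (MulAction.orbit T B) := by
  intro β _ _ T _ B hBne
  classical
  set K := ((MulAction.toPermHom T (orbit T B)).ker).map T.subtype with hK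
  set TB := (stabilizer T B).map T.subtype with hTB
  set res := restr TB (fun u => u ∈ B) (stabilizer_apply_mem_iff T B) with hres
  set P := res.range with hP
  -- for each translate `C` choose `g_C ∈ T` with `g_C • B = C`
  have hch : ∀ C : orbit T B, ∃ g : Perm β, g ∈ T ∧ g • B = C := fun C =>
    let ⟨g, hg, h⟩ := (mem_orbit_subgroup_iff T B C).1 C.2; ⟨g, hg, h⟩
  choose g hgT hgB using hch
  -- conjugation into the stabiliser
  have hmem : ∀ (k : K) (C : orbit T B), (g C)⁻¹ * k * g C ∈ TB := by
    intro k C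
    have hk := (mem_kernel_iff T B k).1 k.2
    refine (mem_stabilizer_map_iff T B _).2 ⟨T.mul_mem (T.mul_mem (T.inv_mem (hgT C)) hk.1) (hgT C), ?_⟩
    rw [mul_smul, mul_smul, hgB C, hk.2 _ C.2, ← hgB C, inv_smul_smul]
  let ψ : K → (orbit T B → P) := fun k C => ⟨res ⟨_, hmem k C⟩, ⟨_, rfl⟩⟩
  have hψ : Function.Injective ψ := by
    intro k k' hkk'
    apply Subtype.ext
    ext v
    obtain ⟨C, hC, hv⟩ := exists_mem_translate T B hBne v
    have h1 := congrArg (fun f => ((f ⟨C, hC⟩ : P) : Perm {u // u ∈ B})) hkk'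
    simp only [ψ] at h1
    -- evaluate at `u := (g C)⁻¹ v ∈ B`
    have hu : (g ⟨C, hC⟩)⁻¹ v ∈ B := by
      rw [← mem_smul_finset_iff_inv_apply_mem, hgB ⟨C, hC⟩]; exact hv
    have h2 := congrArg (fun f : Perm {u // u ∈ B} => ((f ⟨_, hu⟩ : {u // u ∈ B}) : β)) h1
    simp only [hres, restr_apply_coe, Perm.coe_mul, Function.comp_apply] at h2
    rw [perm_apply_inv_self] at h2
    exact (g ⟨C, hC⟩)⁻¹.injective h2
  calc Nat.card K ≤ Nat.card (orbit T B → P) := Nat.card_le_card_of_injective ψ hψ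
    _ = Nat.card P ^ Nat.card (orbit T B) := Nat.card_fun

end Summit.PneNP.PneNP.Theorems
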